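import Summits.BirchSwinnertonDyer.BirchSwinnertonDyer.Theorems.GenusKolyvaginAtTwoGenusDeepSupplyAtTwoNegDiscNarrowHalvingBitOfTwinHalves
import Summits.BirchSwinnertonDyer.Rank1Residual.X11b.BDPRouteRankOneBookkeeping
import HarnessLib

/-!
# Route `GenusKolyvaginAtTwo`, crux `GenusDeepSupplyAtTwoNegDiscNarrow` (stmt-BirchSwinnertonDyer-23491) / K₄⁻ `K4Neg` (31526), LINE 38 —
# THE HALVING BIT IS THE STEERING CLAUSE: `hHalf ⟺ SteerAt W ℓ₀` on every prime Heegner frame (exact dictionary, K-bit = ℚ-bit)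

LEAD seat `bsd-line-gk2-p1` g30 (cell `bsd-f1-sign2`), sequel of `…HalvingBitOfTwinHalves` (p793302), `--supports stmt-BirchSwinnertonDyer-23491
--as helper`.  THEOREMS ONLY (no definition, no named fact, no `sorry`); standard axioms.  **BSD is NOT proved by this file; crux 23491 / `K4Neg` /
U₂ / Q2 / WALL are NOT proved; nothing is closed by it.**

WHAT.  The previous file proved `SteerAt W ℓ₀ ⟹ hHalf` (LINE 38's H).  This file proves the CONVERSE on the same frame once the twin has rank
`1` (`r_an(Wd) = 1` + GZK `MultPublishedInputsAtTwo`), so that the LEAD g28's one-bit residual `hHalf` of the K₄⁻ cell — a statement about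
halves of `K`-points in `E_K(K̄)` — is EXACTLY the ℚ-side steering clause of LINE 38 (gk2-p5's twisting-prime output clause; by gk2-p4 g35
`forall_selmer_twist_eq_zero_iff_steerAt` / `…_iff_selmer_dying_imp_not_four_dvd` also `⟺ 𝒩(Wd) ⟺ «ξ_E ∈ Sel₂(E) → 4 ∤ a_{ℓ₀}(E)»`):

* `steerAt_of_halvingBit` — `hHalf ⟹ SteerAt W ℓ₀`: if a non-zero Selmer phantom `y` of `W` is strict at `ℓ₀`, gk2-p4 §48 (⟸) makes every half
  `Q_d` of a non-divisible rational twin point `P` (one exists: `rank E^{(d_K)}(ℚ) = 1`, coordinate `c` with `c(P) = 1`) `Γ_{ℚ(E[4])}`-fixed; then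
  `θ(F Q_d)` is a `Γ_{K(E[4])}`-fixed half of the `K`-point `Y` under `F P̃`, `hHalf` halves `Y = 2S` in `E(K)`, and the anti-invariant multiple
  `m•S` (`m` odd) is a rational twin point `z` with `2z = m•P` — impossible since `c(2z)` is even and `c(m•P) = m` is odd.
* ★★★ `halvingBit_iff_steerAt` — **`hHalf ⟺ SteerAt W ℓ₀`** on a prime Heegner frame of a rank-`0` curve whose twin has analytic rank `1`
  (frame of K4Neg / LINE 38; PRINT: GZK).  Census reading (LEAD-BRIEF-g29 §3 made kernel in ℚ-currency): the LEAD road's residual bit on the K₄⁻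
  cell is a Čebotarev datum of the twisting prime — `Frob_{ℓ₀}` of order `4` in `Gal(ℚ(E[4])/ℚ)` when `ξ_E ∈ Sel₂(E)`, nothing when `ξ_E ∉ Sel₂(E)`.

References: [SilvermanAEC2009] X.5 Cor. 5.4, VIII.§1–§2, VIII.6.7; [MazurRubin2010] Def. 3.1, Lemma 2.10–2.11, Prop. 3.3; [LawsonWuthrich2016] §3,
§7.1; [GrossZagier1986] / [Kolyvagin1989] (GZK, by name).
-/

set_option linter.dupNamespace false -- tree convention: `Summit.BirchSwinnertonDyer.BirchSwinnertonDyer.Theorems` (summit = sub-problem)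
set_option autoImplicit false

noncomputable section

open scoped Classical Pointwise

namespace Summit.BirchSwinnertonDyer.BirchSwinnertonDyer.Theorems.GenusExact.PlusDescent.TwinHalves

open WeierstrassCurve Field NumberField IsDedekindDomain
open Literature.NumberTheory.GaloisRepresentations Literature.NumberTheory.EllipticCurves
open Summit.BirchSwinnertonDyer.BirchSwinnertonDyer.Theorems.GenusSupplyNarrow.DepthZero
  (exists_twistIso_sign_absGaloisQuot exists_twin_point_of_anti)
open Summit.BirchSwinnertonDyer.BirchSwinnertonDyer.Theorems.GenusExact.PhantomDescentBit
  (pointsEquiv_map_absEmbedding_eq_toGeomPoints pointsEquiv_symm_smul forall_fixed_odd_torsion_of_rank_zero)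
open Summit.BirchSwinnertonDyer.BirchSwinnertonDyer.Theorems.GenusExact.PlusDescent.SocleSelection.RealVisible
  (mem_torsionFixing_baseChange_iff)
open Summit.BirchSwinnertonDyer.BirchSwinnertonDyer.Theses.GenusKolyvaginAtTwo (MultPublishedInputsAtTwo)
open Summit.BirchSwinnertonDyer.BirchSwinnertonDyer.Theorems.GenusKolyTwistingPrime
  (forall_torsionFixing_four_smul_eq_iff_exists_selmer strictLocalKer_eq_torsionLocalKer)

/-! ## §4 The converse: `hHalf ⟹ SteerAt W ℓ₀` when the twin has rank `1` -/

/-- **`hHalf ⟹ SteerAt W ℓ₀`.**  `E = W/ℚ` globally minimal with `Δ < 0`, analytic rank `0` and `ρ_{E,2^n}` onto; `K` imaginary quadratic with odd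
`d_K = −ℓ₀`, Heegner for `N_E`, `2` split; `Wd` an elliptic model of the twist `E^{(d_K)}` with analytic rank `1` and `#Sel₂(Wd) = 2`; GZK
(`MultPublishedInputsAtTwo`: `rank E(ℚ) = 0`, `rank Wd(ℚ) = 1`).  IF every `R ∈ E(K)` with a `Γ_{K(E[4])}`-fixed half lies in `2E(K)` (the LEAD's
halving bit), THEN every non-zero class of `Sel₂(W)` dying on `Γ_{ℚ(W[4])}` is NOT locally trivial at `ℓ₀` (the steering clause).  Proof in the
module docstring.  CONDITIONAL only on the PRINT item GZK; BSD is NOT proved; nothing is closed.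
[cite: MazurRubin2010, Def. 3.1, Lemma 2.10–2.11, Prop. 3.3] [cite: SilvermanAEC2009, X.5 Cor. 5.4, VIII.§2, Thm. VIII.6.7] [cite: LawsonWuthrich2016, §3] -/
theorem steerAt_of_halvingBit
    (W : WeierstrassCurve ℚ) [W.IsElliptic] [W.IsGloballyMinimal]
    (hr0 : W.analyticRank = 0) (hρ : ∀ n : ℕ, 0 < n → W.HasSurjectiveModNGaloisRep ((2 : ℤ) ^ n)) (hneg : W.Δ < 0)
    (K : Type) [Field K] [NumberField K] (hIQ : IsImaginaryQuadratic K) (hodd : Odd (discr K))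
    (hHe : SatisfiesHeegnerHypothesis (W.conductorNorm ℤ) K)
    (ℓ₀ : ℕ) [Fact ℓ₀.Prime] (hdK : discr K = -(ℓ₀ : ℤ)) (h2K : ((Ideal.span {(2 : ℤ)}).primesOver (𝓞 K)).ncard = 2)
    (Wd : WeierstrassCurve ℚ) [Wd.IsElliptic] (hWd : ∃ C : VariableChange ℚ, C • W.quadraticTwist (discr K : ℚ) = Wd)
    (hrd : Wd.analyticRank = 1) (hSel : Nat.card (Wd.selmerGroup 2) = 2) (hGZK : MultPublishedInputsAtTwo)
    (hHalf : ∀ (R : (W.baseChange K).toAffine.Point) (Q : geomPoints (W.baseChange K)),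
      (∀ ρ ∈ torsionFixing (W.baseChange K) (4 : ℤ), ρ • Q = Q) → (2 : ℤ) • Q = toGeomPoints (W.baseChange K) R →
      ∃ R' : (W.baseChange K).toAffine.Point, (2 : ℤ) • R' = R) :
    ∀ y : galH1Torsion W (2 : ℤ), y ∈ W.selmerGroup 2 → y ≠ 0 →
      (∀ h ∈ torsionFixing W (4 : ℤ), h1Eval W (2 : ℤ) y h = 0) → y ∉ W.torsionLocalKer ℚ_[ℓ₀] (2 : ℤ) := by
  letI instD : DecidableEq ℚ := fun a b ↦ Classical.propDecidable (a = b)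
  intro y hyS hy0 hyd hys
  have h2 : Module.finrank ℚ K = 2 := hIQ.1
  haveI : Algebra.IsQuadraticExtension ℚ K := ⟨h2⟩
  haveI : IsGalois ℚ K := inferInstance
  haveI : PerfectField ℚ := PerfectField.ofCharZero
  haveI : PerfectField K := PerfectField.ofCharZero
  -- the twin `V := W.quadraticTwist d_K` itself: a model (`C = 1`) with `#Sel₂ = 2` and rank `1`
  have hd0 : (discr K : ℚ) ≠ 0 := by exact_mod_cast NumberField.discr_ne_zero K
  haveI := W.isElliptic_quadraticTwist hd0
  set V := W.quadraticTwist (discr K : ℚ) with hVdef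
  obtain ⟨C, hC⟩ := hWd
  have hSel' : Nat.card (V.selmerGroup 2) = 2 := by rw [natCard_selmerGroup_eq_of_variableChange (2 : ℤ) hC, hSel]
  have h1 : (1 : VariableChange ℚ) • V = V := one_smul _ _
  have hrkV : V.mordellWeilRank = 1 := by
    rw [← mordellWeilRank_variableChange_holds V C, hC, (hGZK Wd (by rw [hrd])).1, hrd]
  -- `E(ℚ)` is torsion (rank `0` through GZK), read in `E(ℚ̄)`; `τ` and the odd-torsion trick
  have hrk0 : W.mordellWeilRank = 0 := by rw [(hGZK W (by rw [hr0]; exact zero_le_one)).1, hr0]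
  haveI : Finite W.toAffine.Point := W.mordellWeilRank_eq_zero_iff_finite.mp hrk0
  have htor : ∀ s : W.toAffine.Point, IsOfFinAddOrder (WeierstrassCurve.toGeomPoints W s) :=
    isOfFinAddOrder_toGeomPoints_of_finite W
  have hcard : Nat.card (K ≃ₐ[ℚ] K) = 2 := by rw [IsGalois.card_aut_eq_finrank, h2]
  obtain ⟨τ, hτ1⟩ : ∃ τ : K ≃ₐ[ℚ] K, τ ≠ 1 := by
    by_contra h
    push Not at h
    haveI : Subsingleton (K ≃ₐ[ℚ] K) := ⟨fun a b ↦ (h a).trans (h b).symm⟩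
    have := hcard ▸ Nat.card_of_subsingleton (1 : K ≃ₐ[ℚ] K)
    omega
  have hττ : τ * τ = 1 := by
    rcases Literature.NumberTheory.QuadraticFields.eq_one_or_eq_of_card_eq_two hcard hτ1 (τ * τ) with h | h
    · exact h
    · exact absurd (mul_left_cancel (a := τ) (h.trans (mul_one τ).symm)) hτ1
  -- a rational twin point `P` with `c(P) = 1` (so `P ∉ 2V(ℚ)`) and a half `Qd`
  obtain ⟨c, P, hcP, -⟩ := Summit.BirchSwinnertonDyer.Rank1Residual.X11b.RankOne.exists_coord_of_mordellWeilRank_eq_one V hrkV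
  have hP2 : ¬ ∃ P' : V.toAffine.Point, (2 : ℤ) • P' = P := by
    rintro ⟨P', hP'⟩
    have h := congrArg c hP'
    rw [map_zsmul, hcP, smul_eq_mul] at h
    omega
  obtain ⟨Qd, hQd'⟩ := V.zsmul_geomPoints_surjective_of_charZero two_ne_zero (toGeomPoints V P)
  have hQd : (2 : ℤ) • Qd = toGeomPoints V P := hQd'
  have hPfix : ∀ T ∈ geomTorsion V (2 : ℤ), Qd - T ∉ MulAction.fixedPoints (absoluteGaloisGroup ℚ) V.geomPoints := by
    intro T hT hfixT
    obtain ⟨z'', hz''⟩ := V.exists_toGeomPoints_eq_of_forall_smul_eq (Q := Qd - T) hfixT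
    have hT2 : (2 : ℤ) • T = 0 := (mem_geomTorsion_iff V (2 : ℤ) T).mp hT
    exact hP2 ⟨z'', toGeomPoints_injective V (by rw [map_zsmul, hz'', smul_sub, hT2, sub_zero, hQd])⟩
  -- §48 (⟸): the strict dying Selmer class entangles the twin — every `h ∈ Γ_{ℚ(E[4])}` fixes `Qd`
  have hent : ∀ h ∈ torsionFixing W (4 : ℤ), h • Qd = Qd :=
    (forall_torsionFixing_four_smul_eq_iff_exists_selmer W hneg hIQ hodd hHe h2K hdK h1 hSel' P Qd hQd hPfix).mpr
      ⟨y, hyS, hy0, hyd, by rw [strictLocalKer_eq_torsionLocalKer]; exact hys⟩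
  -- the signed untwisting and the dictionary
  obtain ⟨F, hF⟩ := exists_twistIso_sign_absGaloisQuot W hIQ
  have hFplus : ∀ σ : absoluteGaloisGroup ℚ, absGaloisQuot ℚ K σ = 1 → ∀ X : V.geomPoints, F (σ • X) = σ • F X := fun σ hσ X ↦ by
    rcases hF σ with ⟨-, h⟩ | ⟨hne, -⟩
    · exact h X
    · exact absurd hσ hne
  set θ := RatClosure.pointsEquiv (K := K) W with hθdef
  -- `θ (F P̃)` is `Γ_K`-fixed, hence `ι Y` for some `Y ∈ E(K)`
  have hYfix : ∀ ρ : absoluteGaloisGroup K, ρ • θ (F (toGeomPoints V P)) = θ (F (toGeomPoints V P)) := fun ρ ↦ by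
    rw [← RatClosure.pointsEquiv_smul, ← hFplus _ (absGaloisQuot_absGaloisRestrict ℚ K ρ), smul_toGeomPoints]
  obtain ⟨Y, hY⟩ := (W.baseChange K).exists_toGeomPoints_eq_of_forall_smul_eq hYfix
  -- `θ (F Qd)` is a `Γ_{K(E[4])}`-fixed half of `ι Y`; `hHalf` halves `Y`
  have hQK : (2 : ℤ) • θ (F Qd) = toGeomPoints (W.baseChange K) Y := by rw [← map_zsmul, ← map_zsmul, hQd, hY]
  have hQKfix : ∀ ρ ∈ torsionFixing (W.baseChange K) (4 : ℤ), ρ • θ (F Qd) = θ (F Qd) := by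
    intro ρ hρ4
    have hres : absGaloisRestrict ℚ K ρ ∈ torsionFixing W (4 : ℤ) := (mem_torsionFixing_baseChange_iff W K (4 : ℤ) ρ).mp hρ4
    rw [← RatClosure.pointsEquiv_smul, ← hFplus _ (absGaloisQuot_absGaloisRestrict ℚ K ρ), hent _ hres]
  obtain ⟨S, hS⟩ := hHalf Y (θ (F Qd)) hQKfix hQK
  -- `S + τS` is `Aut`-fixed, hence killed by an odd `m`; `A := m • S` is anti-invariant, a twin point `z`
  have hSfix : ∀ σ : K ≃ₐ[ℚ] K, σ • (S + τ • S) = S + τ • S := by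
    intro σ
    rcases Literature.NumberTheory.QuadraticFields.eq_one_or_eq_of_card_eq_two hcard hτ1 σ with rfl | rfl
    · exact one_smul _ _
    · rw [smul_add, ← mul_smul, hττ, one_smul, add_comm]
  obtain ⟨m, hm, hmS⟩ := forall_fixed_odd_torsion_of_rank_zero W hρ hIQ htor (S + τ • S) hSfix
  have hanti : τ • ((m : ℤ) • S) = -((m : ℤ) • S) := by
    have hτS : τ • S = -S + (S + τ • S) := by abel
    have hsm : τ • ((m : ℤ) • S) = (m : ℤ) • (τ • S) := map_zsmul (DistribSMul.toAddMonoidHom _ τ) (m : ℤ) S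
    rw [hsm, hτS, smul_add, hmS, add_zero, smul_neg]
  obtain ⟨z, hz⟩ := exists_twin_point_of_anti W hIQ hτ1 F hF hanti
  -- `2 z̃ = m P̃`: compare images under `θ ∘ F`
  have h2z : (2 : ℤ) • z = (m : ℤ) • P := by
    apply toGeomPoints_injective V
    apply F.injective
    apply θ.injective
    have lhs : θ (F (toGeomPoints V ((2 : ℤ) • z))) = (m : ℤ) • toGeomPoints (W.baseChange K) Y := by
      rw [map_zsmul, map_zsmul, map_zsmul, hz, pointsEquiv_map_absEmbedding_eq_toGeomPoints, map_zsmul, smul_comm,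
        ← map_zsmul, hS]
    have rhs : θ (F (toGeomPoints V ((m : ℤ) • P))) = (m : ℤ) • toGeomPoints (W.baseChange K) Y := by
      rw [map_zsmul, map_zsmul, map_zsmul, hY]
    rw [lhs, rhs]
  -- parity contradiction through the coordinate `c`
  have h := congrArg c h2z
  rw [map_zsmul, map_zsmul, hcP, smul_eq_mul, smul_eq_mul, mul_one] at h
  obtain ⟨k, hk⟩ := hm
  omega

/-- ★★★ **THE HALVING BIT IS THE STEERING CLAUSE: `hHalf ⟺ SteerAt W ℓ₀`** on a prime Heegner frame of a rank-`0` curve whose twin has analytic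
rank `1` (the frame of `K4Neg` / LINE 38: `E = W/ℚ` globally minimal, `Δ < 0`, `r_an(E) = 0`, `ρ_{E,2^n}` onto; `K = ℚ(√−ℓ₀)`, `d_K` odd, Heegner,
`2` split; `Wd` a model of `E^{(d_K)}` with `r_an(Wd) = 1`, `#Sel₂(Wd) = 2`; GZK `MultPublishedInputsAtTwo`).  `⟸` is `halvingBit_of_steerAt`
(p793302), `⟹` is `steerAt_of_halvingBit`.  With gk2-p4 g35's dictionary the LEAD g28's one-bit residual of the K₄⁻ cell reads, in the kernel:
`hHalf ⟺ SteerAt ⟺ 𝒩(Wd) ⟺ (ξ_E ∈ Sel₂(E) → 4 ∤ a_{ℓ₀}(E))`.  CONDITIONAL only on the PRINT item GZK; BSD is NOT proved; K4Neg is NOT proved;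
nothing is closed. [cite: MazurRubin2010, Def. 3.1, Lemma 2.10–2.11, Prop. 3.3] [cite: LawsonWuthrich2016, §3, §7.1] [cite: SilvermanAEC2009, X.5 Cor. 5.4, VIII.§2] -/
theorem halvingBit_iff_steerAt
    (W : WeierstrassCurve ℚ) [W.IsElliptic] [W.IsGloballyMinimal]
    (hr0 : W.analyticRank = 0) (hρ : ∀ n : ℕ, 0 < n → W.HasSurjectiveModNGaloisRep ((2 : ℤ) ^ n)) (hneg : W.Δ < 0)
    (K : Type) [Field K] [NumberField K] (hIQ : IsImaginaryQuadratic K) (hodd : Odd (discr K))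
    (hHe : SatisfiesHeegnerHypothesis (W.conductorNorm ℤ) K)
    (ℓ₀ : ℕ) [Fact ℓ₀.Prime] (hdK : discr K = -(ℓ₀ : ℤ)) (h2K : ((Ideal.span {(2 : ℤ)}).primesOver (𝓞 K)).ncard = 2)
    (Wd : WeierstrassCurve ℚ) [Wd.IsElliptic] (hWd : ∃ C : VariableChange ℚ, C • W.quadraticTwist (discr K : ℚ) = Wd)
    (hrd : Wd.analyticRank = 1) (hSel : Nat.card (Wd.selmerGroup 2) = 2) (hGZK : MultPublishedInputsAtTwo) :
    (∀ (R : (W.baseChange K).toAffine.Point) (Q : geomPoints (W.baseChange K)),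
      (∀ ρ ∈ torsionFixing (W.baseChange K) (4 : ℤ), ρ • Q = Q) → (2 : ℤ) • Q = toGeomPoints (W.baseChange K) R →
      ∃ R' : (W.baseChange K).toAffine.Point, (2 : ℤ) • R' = R) ↔
    (∀ y : galH1Torsion W (2 : ℤ), y ∈ W.selmerGroup 2 → y ≠ 0 →
      (∀ h ∈ torsionFixing W (4 : ℤ), h1Eval W (2 : ℤ) y h = 0) → y ∉ W.torsionLocalKer ℚ_[ℓ₀] (2 : ℤ)) :=
  ⟨steerAt_of_halvingBit W hr0 hρ hneg K hIQ hodd hHe ℓ₀ hdK h2K Wd hWd hrd hSel hGZK,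
    halvingBit_of_steerAt W hr0 hρ hneg K hIQ hodd hHe ℓ₀ hdK h2K Wd hWd hSel hGZK⟩

end Summit.BirchSwinnertonDyer.BirchSwinnertonDyer.Theorems.GenusExact.PlusDescent.TwinHalves

end
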